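import Summits.BirchSwinnertonDyer.BirchSwinnertonDyer.Theorems.Rank2Observatory2DescLinGens
import Literature.NumberTheory.NumberFields.ClassGroupCertDK
import Mathlib.RingTheory.DedekindDomain.AdicValuation
import Mathlib.NumberTheory.LegendreSymbol.Basic
import HarnessLib

/-!
# BirchSwinnertonDyer — rank ≥ 2 observatory: the primes above `p` in an explicit cubic field (KERNEL-2DESC-CL, N7)

HONEST FRAMING: per-curve certified theorems and census instruments; no claim on BSD in rank ≥ 2.

Generic file N7 of the class-group-general cubic-field `2`-descent (design
`b2b-bsdr2-cert-1/KERNEL-2DESC-CL.md`). Without class number one the primes of the `T`-unit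
descent are ideals `(p, G(θ))`, not prime elements, and the per-field / per-curve certificates
need, for an explicit monic cubic `f = X³ + aX² + bX + c` with root `θ` and a prime
`p ∤ exponent(θ)`:

* `span_pair_mem_primesOver` — **Dedekind–Kummer, constructive direction**: a lift `Q` of a monic
  irreducible factor of `f mod p` gives the prime `(p, Q(θ))` above `p` of residue degree `deg Q̄`
  (Mathlib `NumberField.Ideal.primesOverSpanEquivMonicFactorsMod`), hence its absolute norm
  (`absNorm_span_pair_eq`);
* `exists_eq_span_pair_of_prod_eq` — **covering without factorisation theory**: if
  `∏ Gᵢ^{eᵢ} = p · H` in `𝓞 K` and every `(p, Gᵢ)` is maximal, every prime containing `p` is one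
  of the `(p, Gᵢ)`;
* the packaged certificates `primesOver_split` (splitting types `(1)(1)(1)`, `(1)(1)²`, `(1)³`:
  root data `r₁ r₂ r₃` with `f = ∏ (X − rᵢ) + p·S` in `ℤ[X]`) and `primesOver_one_two` (type
  `(1)(2)`: `f = (X − r)(X² + uX + v) + p·S` with `X² + uX + v` rootless mod `p`, certified by a
  Legendre symbol `((u² − 4v)/p) = −1` or by enumeration), each returning the primes above `p` as
  `(p, lin …)`, their norms, and the statement that there are no others; inert primes are
  Literature's `MonicCubic.eq_span_of_no_root'`.
[cite: Marcus2018, Ch. 3, Thm. 27 (Dedekind–Kummer)]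
[cite: Cohen1993, §4.8.2 (prime decomposition from the factorisation of `f mod p`), §6.2]

## References
* D. A. Marcus, *Number Fields*, 2nd ed. (2018), Ch. 3, Thm. 27. [Marcus2018]
* H. Cohen, *A Course in Computational Algebraic Number Theory*, GTM 138 (1993), §4.8.2, §6.2.
  [Cohen1993]
-/

-- single-conjunct summit: `Summit.BirchSwinnertonDyer.BirchSwinnertonDyer.…` repeats the name by design
set_option linter.dupNamespace false

noncomputable section

open scoped Classical NumberField nonZeroDivisors

namespace Summit.BirchSwinnertonDyer.BirchSwinnertonDyer.Rank2Observatory.TwoDescCl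

open IsDedekindDomain NumberField Ideal Polynomial
open Literature.NumberTheory.NumberFields Literature.NumberTheory.NumberFields.MonicCubic
open TwoDescCubic (lin)

variable {K : Type*} [Field K] [NumberField K] {a b c : ℤ} {θ : K}

/-! ## Dedekind–Kummer, constructive direction -/

/-- **`(p, Q(θ))` is a prime above `p` of residue degree `deg Q̄`** for a lift `Q` of a monic
irreducible factor `Q̄` of `f mod p`, `p ∤ exponent(θ)`. [cite: Marcus2018, Ch. 3, Thm. 27] -/
theorem span_pair_mem_primesOver (hirr : Irreducible (polyQ a b c))
    (hθ : aeval θ (poly a b c) = 0) {p : ℕ} (hp : p.Prime)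
    (hexp : ¬ p ∣ RingOfIntegers.exponent (thetaInt hθ)) (Q : ℤ[X])
    (hQirr : Irreducible (Q.map (Int.castRingHom (ZMod p))))
    (hQmon : (Q.map (Int.castRingHom (ZMod p))).Monic)
    (hQdvd : Q.map (Int.castRingHom (ZMod p)) ∣ polyMod a b c p) :
    span {(p : 𝓞 K), aeval (thetaInt hθ) Q} ∈ primesOver (span {(p : ℤ)}) (𝓞 K) ∧
      (span {(p : 𝓞 K), aeval (thetaInt hθ) Q}).inertiaDeg ℤ =
        (Q.map (Int.castRingHom (ZMod p))).natDegree := by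
  haveI := Fact.mk hp
  have hmem : Q.map (Int.castRingHom (ZMod p)) ∈
      RingOfIntegers.monicFactorsMod (thetaInt hθ) p := by
    simp only [RingOfIntegers.monicFactorsMod, Multiset.mem_toFinset, minpoly_thetaInt hirr hθ]
    exact (Polynomial.mem_normalizedFactors_iff (monic_polyMod a b c p).ne_zero).mpr
      ⟨hQirr, hQmon, hQdvd⟩
  have h1 := NumberField.Ideal.primesOverSpanEquivMonicFactorsMod_symm_apply_eq_span hexp hmem
  have h2 := NumberField.Ideal.inertiaDeg_primesOverSpanEquivMonicFactorsMod_symm_apply hexp hmem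
  refine ⟨?_, ?_⟩
  · rw [← h1]; exact Subtype.prop _
  · rw [← h1, h2]

/-- `(p, x) ≠ ⊥`. [folklore] -/
theorem span_pair_ne_bot {p : ℕ} (hp : p.Prime) (x : 𝓞 K) : span {(p : 𝓞 K), x} ≠ ⊥ := by
  intro h
  rw [Ideal.span_eq_bot] at h
  have h1 : (p : 𝓞 K) = 0 := h (p : 𝓞 K) (Set.mem_insert _ _)
  exact hp.ne_zero (Nat.cast_eq_zero.mp h1)

/-- **Norm of `(p, Q(θ))`**: `p ^ deg Q̄`. [cite: Marcus2018, Ch. 3, Thm. 27] -/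
theorem absNorm_span_pair_eq (hirr : Irreducible (polyQ a b c))
    (hθ : aeval θ (poly a b c) = 0) {p : ℕ} (hp : p.Prime)
    (hexp : ¬ p ∣ RingOfIntegers.exponent (thetaInt hθ)) (Q : ℤ[X])
    (hQirr : Irreducible (Q.map (Int.castRingHom (ZMod p))))
    (hQmon : (Q.map (Int.castRingHom (ZMod p))).Monic)
    (hQdvd : Q.map (Int.castRingHom (ZMod p)) ∣ polyMod a b c p) :
    absNorm (span {(p : 𝓞 K), aeval (thetaInt hθ) Q}) =
      p ^ (Q.map (Int.castRingHom (ZMod p))).natDegree := by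
  obtain ⟨hmem, hdeg⟩ := span_pair_mem_primesOver hirr hθ hp hexp Q hQirr hQmon hQdvd
  haveI := hmem.1
  haveI := hmem.2
  rw [← hdeg, Ideal.pow_inertiaDeg]

/-! ## Covering: every prime above `p` is listed -/

omit [NumberField K] in
/-- **Every prime containing `p` is one of the `(p, Gᵢ)`** when `∏ Gᵢ^{eᵢ} = p · H` and the
`(p, Gᵢ)` are maximal. [folklore] -/
theorem exists_eq_span_pair_of_prod_eq (p : ℕ) {k : ℕ} (G : Fin k → 𝓞 K) (e : Fin k → ℕ)
    (H : 𝓞 K) (hprod : ∏ i, G i ^ e i = p * H)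
    (hmax : ∀ i, (span {(p : 𝓞 K), G i}).IsMaximal)
    (P : Ideal (𝓞 K)) (hP : P.IsPrime) (hpP : (p : 𝓞 K) ∈ P) :
    ∃ i, P = span {(p : 𝓞 K), G i} := by
  have hmem : ∏ i, G i ^ e i ∈ P := by rw [hprod]; exact P.mul_mem_right _ hpP
  haveI := hP
  obtain ⟨i, -, hi⟩ := Ideal.IsPrime.prod_mem_iff.mp hmem
  have hG : G i ∈ P := hP.mem_of_pow_mem _ hi
  have hle : span {(p : 𝓞 K), G i} ≤ P := by
    rw [Ideal.span_le]
    intro x hx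
    rcases hx with rfl | hx
    · exact hpP
    · rw [Set.mem_singleton_iff] at hx; rw [hx]; exact hG
  exact ⟨i, ((hmax i).eq_of_le hP.ne_top hle).symm⟩

/-! ## Factors of `f mod p` from an integer identity -/

omit [Field K] [NumberField K] in
/-- From `f = ∏ Gᵢ^{eᵢ} + p·S` in `ℤ[X]`: each `Ḡᵢ` (with `eᵢ > 0`) divides `f mod p`. [folklore] -/
theorem map_dvd_polyMod_of_eq {p : ℕ} {k : ℕ} (G : Fin k → ℤ[X]) (e : Fin k → ℕ) (S : ℤ[X])
    (hfac : poly a b c = ∏ i, G i ^ e i + C (p : ℤ) * S) (i : Fin k) (hi : 0 < e i) :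
    (G i).map (Int.castRingHom (ZMod p)) ∣ polyMod a b c p := by
  have h0 : polyMod a b c p = ∏ j, (G j).map (Int.castRingHom (ZMod p)) ^ e j := by
    rw [polyMod, hfac, Polynomial.map_add, Polynomial.map_mul, Polynomial.map_C,
      Polynomial.map_prod]
    simp only [Polynomial.map_pow, eq_intCast, Int.cast_natCast, ZMod.natCast_self, map_zero,
      zero_mul, add_zero]
  rw [h0]
  exact (dvd_pow_self _ hi.ne').trans (Finset.dvd_prod_of_mem _ (Finset.mem_univ i))

/-- From `f = ∏ Gᵢ^{eᵢ} + p·S` in `ℤ[X]`: `∏ Gᵢ(θ)^{eᵢ} = p · (−S(θ))` in `𝓞 K`. [folklore] -/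
theorem prod_aeval_eq_of_eq (hθ : aeval θ (poly a b c) = 0) {p : ℕ} {k : ℕ} (G : Fin k → ℤ[X])
    (e : Fin k → ℕ) (S : ℤ[X]) (hfac : poly a b c = ∏ i, G i ^ e i + C (p : ℤ) * S) :
    ∏ i, aeval (thetaInt hθ) (G i) ^ e i = (p : 𝓞 K) * (-aeval (thetaInt hθ) S) := by
  have h := aeval_thetaInt hθ
  rw [hfac, map_add, map_mul, map_prod, aeval_C] at h
  simp only [map_pow, algebraMap_int_eq, Int.coe_castRingHom, Int.cast_natCast] at h
  linear_combination h

/-! ## Irreducibility certificates modulo `p` -/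

omit [Field K] [NumberField K] in
/-- `X − r̄` data. [folklore] -/
theorem map_X_sub_C {p : ℕ} (r : ℤ) :
    (X - C r : ℤ[X]).map (Int.castRingHom (ZMod p)) = X - C (r : ZMod p) := by
  rw [Polynomial.map_sub, Polynomial.map_X, Polynomial.map_C, eq_intCast]

omit [Field K] [NumberField K] in
/-- `X² + ūX + v̄` data. [folklore] -/
theorem map_quad {p : ℕ} (u v : ℤ) :
    (X ^ 2 + C u * X + C v : ℤ[X]).map (Int.castRingHom (ZMod p)) =
      X ^ 2 + C (u : ZMod p) * X + C (v : ZMod p) := by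
  rw [Polynomial.map_add, Polynomial.map_add, Polynomial.map_mul, Polynomial.map_pow,
    Polynomial.map_X, Polynomial.map_C, Polynomial.map_C, eq_intCast, eq_intCast]

omit [Field K] [NumberField K] in
/-- `X² + uX + v` as a `Cubic` with `a = 0`, `b = 1`. [folklore] -/
theorem quad_eq_toPoly {R : Type*} [CommRing R] (u v : R) :
    (X ^ 2 + C u * X + C v : R[X]) = (Cubic.mk 0 1 u v).toPoly := by
  simp [Cubic.toPoly]

omit [Field K] [NumberField K] in
/-- **A rootless quadratic is irreducible** over `ZMod p`. [folklore] -/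
theorem irreducible_quad_of_no_root {p : ℕ} [Fact p.Prime] (u v : ZMod p)
    (hnr : ∀ t : ZMod p, t ^ 2 + u * t + v ≠ 0) :
    Irreducible (X ^ 2 + C u * X + C v : (ZMod p)[X]) := by
  refine irreducible_of_degree_le_three_of_not_isRoot ?_ fun t ht => hnr t ?_
  · rw [quad_eq_toPoly, Cubic.natDegree_of_b_ne_zero' one_ne_zero]; decide
  · simpa [IsRoot.def, eval_add, eval_mul, eval_pow, eval_X, eval_C] using ht

omit [Field K] [NumberField K] in
/-- **Legendre certificate**: `((u² − 4v)/p) = −1 ⟹ X² + uX + v` has no root mod `p`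
(`(2t + u)² = u² − 4v` at a root `t`). [folklore] -/
theorem no_root_of_legendreSym {p : ℕ} [Fact p.Prime] (u v : ℤ)
    (hleg : legendreSym p (u ^ 2 - 4 * v) = -1) :
    ∀ t : ZMod p, t ^ 2 + (u : ZMod p) * t + (v : ZMod p) ≠ 0 := by
  intro t ht
  have hsq : IsSquare (((u ^ 2 - 4 * v : ℤ) : ZMod p)) := by
    refine ⟨2 * t + u, ?_⟩
    push_cast
    linear_combination (-4 : ZMod p) * ht
  exact (legendreSym.eq_neg_one_iff p).mp hleg hsq

/-! ## Packaged certificates -/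

omit [NumberField K] in
/-- `aeval θ (X − r) = lin (−r) 1 0`. [folklore] -/
theorem aeval_X_sub_C_eq_lin (hθ : aeval θ (poly a b c) = 0) (r : ℤ) :
    aeval (thetaInt hθ) (X - C r : ℤ[X]) = lin hθ (-r) 1 0 := by
  simp only [map_sub, aeval_X, aeval_C, algebraMap_int_eq, Int.coe_castRingHom, lin]
  push_cast; ring

omit [NumberField K] in
/-- `aeval θ (X² + uX + v) = lin v u 1`. [folklore] -/
theorem aeval_quad_eq_lin (hθ : aeval θ (poly a b c) = 0) (u v : ℤ) :
    aeval (thetaInt hθ) (X ^ 2 + C u * X + C v : ℤ[X]) = lin hθ v u 1 := by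
  simp only [map_add, map_mul, map_pow, aeval_X, aeval_C, algebraMap_int_eq, Int.coe_castRingHom,
    lin]
  push_cast; ring

/-- **Splitting types `(1)(1)(1)`, `(1)(1)²`, `(1)³`** (root data): if
`f = (X − r₁)(X − r₂)(X − r₃) + p·S` in `ℤ[X]` and `p ∤ exponent(θ)`, then each
`Pᵢ = (p, θ − rᵢ)` is a prime above `p` of norm `p`, and every prime containing `p` is one of
them. [cite: Marcus2018, Ch. 3, Thm. 27] -/
theorem primesOver_split (hirr : Irreducible (polyQ a b c)) (hθ : aeval θ (poly a b c) = 0)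
    {p : ℕ} (hp : p.Prime) (hexp : ¬ p ∣ RingOfIntegers.exponent (thetaInt hθ))
    (r : Fin 3 → ℤ) (S : ℤ[X])
    (hfac : poly a b c = ∏ i, (X - C (r i)) + C (p : ℤ) * S) :
    (∀ i, span {(p : 𝓞 K), lin hθ (-(r i)) 1 0} ∈ primesOver (span {(p : ℤ)}) (𝓞 K) ∧
        absNorm (span {(p : 𝓞 K), lin hθ (-(r i)) 1 0}) = p) ∧
      ∀ P : Ideal (𝓞 K), P.IsPrime → (p : 𝓞 K) ∈ P →
        ∃ i, P = span {(p : 𝓞 K), lin hθ (-(r i)) 1 0} := by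
  haveI := Fact.mk hp
  have hfac' : poly a b c = ∏ i, (X - C (r i)) ^ (fun _ => 1 : Fin 3 → ℕ) i + C (p : ℤ) * S := by
    simpa only [pow_one] using hfac
  have hdata : ∀ i, Irreducible ((X - C (r i) : ℤ[X]).map (Int.castRingHom (ZMod p))) ∧
      ((X - C (r i) : ℤ[X]).map (Int.castRingHom (ZMod p))).Monic ∧
      ((X - C (r i) : ℤ[X]).map (Int.castRingHom (ZMod p))).natDegree = 1 := by
    intro i
    rw [map_X_sub_C]
    exact ⟨irreducible_X_sub_C _, monic_X_sub_C _, natDegree_X_sub_C _⟩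
  have hP : ∀ i, span {(p : 𝓞 K), lin hθ (-(r i)) 1 0} ∈ primesOver (span {(p : ℤ)}) (𝓞 K) ∧
      absNorm (span {(p : 𝓞 K), lin hθ (-(r i)) 1 0}) = p := by
    intro i
    obtain ⟨hI, hM, hD⟩ := hdata i
    have hdvd := map_dvd_polyMod_of_eq (a := a) (b := b) (c := c) _ _ S hfac' i one_pos
    have h1 := span_pair_mem_primesOver hirr hθ hp hexp _ hI hM hdvd
    have h2 := absNorm_span_pair_eq hirr hθ hp hexp _ hI hM hdvd
    rw [aeval_X_sub_C_eq_lin] at h1 h2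
    rw [hD, pow_one] at h2
    exact ⟨h1.1, h2⟩
  refine ⟨hP, fun P hPp hpP => ?_⟩
  have hprod := prod_aeval_eq_of_eq hθ _ _ S hfac'
  simp only [aeval_X_sub_C_eq_lin] at hprod
  refine exists_eq_span_pair_of_prod_eq p (fun i => lin hθ (-(r i)) 1 0) (fun _ => 1) _ hprod
    (fun i => ?_) P hPp hpP
  exact (hP i).1.1.isMaximal (span_pair_ne_bot hp _)

/-- **Splitting type `(1)(2)`** (root data + rootless quadratic): if
`f = (X − r)(X² + uX + v) + p·S` in `ℤ[X]`, `X² + uX + v` has no root mod `p`, and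
`p ∤ exponent(θ)`, then `P₁ = (p, θ − r)` and `P₂ = (p, θ² + uθ + v)` are primes above `p` of
norms `p`, `p²`, and every prime containing `p` is `P₁` or `P₂`. [cite: Marcus2018, Ch. 3, Thm. 27] -/
theorem primesOver_one_two_of_no_root (hirr : Irreducible (polyQ a b c))
    (hθ : aeval θ (poly a b c) = 0) {p : ℕ} (hp : p.Prime)
    (hexp : ¬ p ∣ RingOfIntegers.exponent (thetaInt hθ)) (r u v : ℤ) (S : ℤ[X])
    (hfac : poly a b c = (X - C r) * (X ^ 2 + C u * X + C v) + C (p : ℤ) * S)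
    (hnr : ∀ t : ZMod p, t ^ 2 + (u : ZMod p) * t + (v : ZMod p) ≠ 0) :
    (span {(p : 𝓞 K), lin hθ (-r) 1 0} ∈ primesOver (span {(p : ℤ)}) (𝓞 K) ∧
        absNorm (span {(p : 𝓞 K), lin hθ (-r) 1 0}) = p) ∧
      (span {(p : 𝓞 K), lin hθ v u 1} ∈ primesOver (span {(p : ℤ)}) (𝓞 K) ∧
        absNorm (span {(p : 𝓞 K), lin hθ v u 1}) = p ^ 2) ∧
      ∀ P : Ideal (𝓞 K), P.IsPrime → (p : 𝓞 K) ∈ P →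
        P = span {(p : 𝓞 K), lin hθ (-r) 1 0} ∨ P = span {(p : 𝓞 K), lin hθ v u 1} := by
  haveI := Fact.mk hp
  set G : Fin 2 → ℤ[X] := ![X - C r, X ^ 2 + C u * X + C v] with hG
  have hfac' : poly a b c = ∏ i, G i ^ (fun _ => 1 : Fin 2 → ℕ) i + C (p : ℤ) * S := by
    rw [hfac, Fin.prod_univ_two]
    simp [hG]
  -- factor data
  have hI₁ : Irreducible ((G 0).map (Int.castRingHom (ZMod p))) := by
    simp only [hG, Matrix.cons_val_zero, map_X_sub_C]; exact irreducible_X_sub_C _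
  have hM₁ : ((G 0).map (Int.castRingHom (ZMod p))).Monic := by
    simp only [hG, Matrix.cons_val_zero, map_X_sub_C]; exact monic_X_sub_C _
  have hD₁ : ((G 0).map (Int.castRingHom (ZMod p))).natDegree = 1 := by
    simp only [hG, Matrix.cons_val_zero, map_X_sub_C]; exact natDegree_X_sub_C _
  have hI₂ : Irreducible ((G 1).map (Int.castRingHom (ZMod p))) := by
    simp only [hG, Matrix.cons_val_one, Matrix.cons_val_zero, map_quad]
    exact irreducible_quad_of_no_root _ _ hnr
  have hM₂ : ((G 1).map (Int.castRingHom (ZMod p))).Monic := by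
    simp only [hG, Matrix.cons_val_one, Matrix.cons_val_zero, map_quad]
    rw [quad_eq_toPoly]; exact Cubic.monic_of_b_eq_one'
  have hD₂ : ((G 1).map (Int.castRingHom (ZMod p))).natDegree = 2 := by
    simp only [hG, Matrix.cons_val_one, Matrix.cons_val_zero, map_quad]
    rw [quad_eq_toPoly]; exact Cubic.natDegree_of_b_ne_zero' one_ne_zero
  have hdvd₁ := map_dvd_polyMod_of_eq (a := a) (b := b) (c := c) _ _ S hfac' 0 one_pos
  have hdvd₂ := map_dvd_polyMod_of_eq (a := a) (b := b) (c := c) _ _ S hfac' 1 one_pos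
  have h1 := span_pair_mem_primesOver hirr hθ hp hexp _ hI₁ hM₁ hdvd₁
  have h1n := absNorm_span_pair_eq hirr hθ hp hexp _ hI₁ hM₁ hdvd₁
  have h2 := span_pair_mem_primesOver hirr hθ hp hexp _ hI₂ hM₂ hdvd₂
  have h2n := absNorm_span_pair_eq hirr hθ hp hexp _ hI₂ hM₂ hdvd₂
  rw [hD₁, pow_one] at h1n
  rw [hD₂] at h2n
  simp only [hG, Matrix.cons_val_zero, Matrix.cons_val_one, aeval_X_sub_C_eq_lin,
    aeval_quad_eq_lin] at h1 h1n h2 h2n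
  refine ⟨⟨h1.1, h1n⟩, ⟨h2.1, h2n⟩, fun P hPp hpP => ?_⟩
  have hprod := prod_aeval_eq_of_eq hθ _ _ S hfac'
  rw [Fin.prod_univ_two] at hprod
  simp only [hG, Matrix.cons_val_zero, Matrix.cons_val_one, pow_one, aeval_X_sub_C_eq_lin,
    aeval_quad_eq_lin] at hprod
  have hmax₁ : (span {(p : 𝓞 K), lin hθ (-r) 1 0}).IsMaximal :=
    h1.1.1.isMaximal (span_pair_ne_bot hp _)
  have hmax₂ : (span {(p : 𝓞 K), lin hθ v u 1}).IsMaximal :=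
    h2.1.1.isMaximal (span_pair_ne_bot hp _)
  obtain ⟨i, hi⟩ := exists_eq_span_pair_of_prod_eq p ![lin hθ (-r) 1 0, lin hθ v u 1]
    (fun _ => 1) _ (by
      rw [Fin.prod_univ_two]
      simpa only [pow_one, Matrix.cons_val_zero, Matrix.cons_val_one] using hprod)
    (fun i => by fin_cases i <;> simpa using by first | exact hmax₁ | exact hmax₂) P hPp hpP
  fin_cases i
  · left; simpa using hi
  · right; simpa using hi

/-- **Splitting type `(1)(2)` with a Legendre-symbol certificate** `((u² − 4v)/p) = −1`.
[cite: Marcus2018, Ch. 3, Thm. 27] -/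
theorem primesOver_one_two (hirr : Irreducible (polyQ a b c))
    (hθ : aeval θ (poly a b c) = 0) {p : ℕ} [hp : Fact p.Prime]
    (hexp : ¬ p ∣ RingOfIntegers.exponent (thetaInt hθ)) (r u v : ℤ) (S : ℤ[X])
    (hfac : poly a b c = (X - C r) * (X ^ 2 + C u * X + C v) + C (p : ℤ) * S)
    (hleg : legendreSym p (u ^ 2 - 4 * v) = -1) :
    (span {(p : 𝓞 K), lin hθ (-r) 1 0} ∈ primesOver (span {(p : ℤ)}) (𝓞 K) ∧
        absNorm (span {(p : 𝓞 K), lin hθ (-r) 1 0}) = p) ∧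
      (span {(p : 𝓞 K), lin hθ v u 1} ∈ primesOver (span {(p : ℤ)}) (𝓞 K) ∧
        absNorm (span {(p : 𝓞 K), lin hθ v u 1}) = p ^ 2) ∧
      ∀ P : Ideal (𝓞 K), P.IsPrime → (p : 𝓞 K) ∈ P →
        P = span {(p : 𝓞 K), lin hθ (-r) 1 0} ∨ P = span {(p : 𝓞 K), lin hθ v u 1} :=
  primesOver_one_two_of_no_root hirr hθ hp.out hexp r u v S hfac (no_root_of_legendreSym u v hleg)

/-! ## `HeightOneSpectrum` packaging -/

/-- A member of `primesOver (p)` as a point of the height-one spectrum. [folklore] -/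
theorem isPrime_and_ne_bot_of_mem_primesOver {p : ℕ} (hp : p.Prime) {x : 𝓞 K}
    (h : span {(p : 𝓞 K), x} ∈ primesOver (span {(p : ℤ)}) (𝓞 K)) :
    (span {(p : 𝓞 K), x}).IsPrime ∧ span {(p : 𝓞 K), x} ≠ ⊥ :=
  ⟨h.1, span_pair_ne_bot hp x⟩

omit [NumberField K] in
/-- Covering in `HeightOneSpectrum` form, two primes. [folklore] -/
theorem heightOneSpectrum_eq_or_eq {p : ℕ} {I₁ I₂ : Ideal (𝓞 K)}
    (hcov : ∀ P : Ideal (𝓞 K), P.IsPrime → (p : 𝓞 K) ∈ P → P = I₁ ∨ P = I₂)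
    (w₁ w₂ : HeightOneSpectrum (𝓞 K)) (h₁ : w₁.asIdeal = I₁) (h₂ : w₂.asIdeal = I₂)
    (w : HeightOneSpectrum (𝓞 K)) (hw : (p : 𝓞 K) ∈ w.asIdeal) : w = w₁ ∨ w = w₂ := by
  rcases hcov w.asIdeal w.isPrime hw with h | h
  · left; exact HeightOneSpectrum.ext (h.trans h₁.symm)
  · right; exact HeightOneSpectrum.ext (h.trans h₂.symm)

omit [NumberField K] in
/-- Covering in `HeightOneSpectrum` form, indexed family. [folklore] -/
theorem exists_heightOneSpectrum_eq {p : ℕ} {k : ℕ} {I : Fin k → Ideal (𝓞 K)}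
    (hcov : ∀ P : Ideal (𝓞 K), P.IsPrime → (p : 𝓞 K) ∈ P → ∃ i, P = I i)
    (w' : Fin k → HeightOneSpectrum (𝓞 K)) (hw' : ∀ i, (w' i).asIdeal = I i)
    (w : HeightOneSpectrum (𝓞 K)) (hw : (p : 𝓞 K) ∈ w.asIdeal) : ∃ i, w = w' i := by
  obtain ⟨i, hi⟩ := hcov w.asIdeal w.isPrime hw
  exact ⟨i, HeightOneSpectrum.ext (hi.trans (hw' i).symm)⟩

end Summit.BirchSwinnertonDyer.BirchSwinnertonDyer.Rank2Observatory.TwoDescCl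

end
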